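import Summits.Parity.GeneralizedHardyLittlewood.Theorems.PrimeLevelFamEdgeMomentsBeyondDiagonalDiagGenericRemEstimate
import Summits.Parity.GeneralizedHardyLittlewood.Theorems.PrimeLevelFamEdgeMomentsBeyondDiagonalDiagGenericAssembly
import HarnessLib

/-!
# Route `PrimeLevelFamEdge`, crux K_A `MomentsBeyondDiagonal` (stmt-Parity-20007), line «petersson_layers» v4:
# **`stub_diag : SubDiag` — the registered stub STUB 2 (the diagonal part `D` has the printed shape), PROVED**

`SubDiag` (deck constant `…PrimeLevelFamEdgeIdeaDeltas.PeterssonLayers.SubDiag`: for some `Δ > 1` and a LEVEL-FREE functional `τ`,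
every order-`(i,j)` piece of the KMV diagonal `D` of the mollified second moment at prime level `q`, mollifier length `q̂^{Δ′}`,
`Δ′ ∈ (1,Δ]`, has the printed shape `2ζ(2)²·q̂/(Δ′²log²q̂)·τ_{ij}(Δ′,P) + O(q̂ log⁻³q̂)`, the pair constraint `m₁m₂ ≲ q̂²` active —
KMV (23)–(28) continued beyond the diagonal) follows BY NAME from

* `…DiagGenericAssembly.subDiag_of_genericRemainder` (lineage famedge-1 g19, p841572): `SubDiag` on the window `(1, 3/2]` from the
  generic remainder estimates (R_ij), `(i,j) ≠ (0,0)`, `i + j` even — the polynomial side (Poly_ij) being the theorem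
  `…DiagGenericPoly.selbergAsymp_orderPoly`, the order `(0,0)` being `…DiagOrderZero`, `τ` chosen from the per-order constants;
* `…DiagGenericRemEstimate.remainder_estimate_gen i j` (this lineage, g20): (R_ij) for every `i + j ≥ 2`, from the generic kernels
  (`…DiagGenericRemKernels`), the both-sided moment families under one constant (`…DiagGenericRemFamilies`, «DRTAIL»_t for all `t`),
  the five-level weight (`…DiagGenericRemWeight`), the inner estimate (`…DiagGenericRemInner`) and the outer `(c,g)` sum.

Honest label: this closes ONE registered stub (`stub_diag`, M/L) of the seven of line «petersson_layers» v4; with `stub_first` (p803664)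
and `stub_identP` (p795653) three satellites are closed; the wall `stub_rung` / `stub_core` (the crux proper, famE-02, open in print) /
`stub_band` and `stub_farP` (Pascadi 2025 Thm 7.1, untyped) remain. K_A (`MomentsBeyondDiagonal`), K_B and the Parity summit are NOT
proved; nothing about GRH or Landau–Siegel zeros. Def-free; one theorem.

## References
* E. Kowalski, P. Michel, J. VanderKam, J. reine angew. Math. 526 (2000), (22)–(28) pp. 12–15 and Prop. 5.1 p. 18.
  [cite: KowalskiMichelVanderKam2000, (23)–(28) and Prop. 5.1 — derivation (diagonal main term of every order, general Q, window (1,3/2])]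
-/

noncomputable section

namespace Summit.Parity.GeneralizedHardyLittlewood.Theorems.MomentsBeyondDiagonal.DiagCorner

open Summit.Parity.GeneralizedHardyLittlewood.Theorems.PrimeLevelFamEdgeIdeaDeltas.PeterssonLayers (SubDiag)
open Summit.Parity.GeneralizedHardyLittlewood.Theorems.MomentsBeyondDiagonal.DiagKernel (subDiag_of_genericRemainder)

/-- **`stub_diag : SubDiag`** — STUB 2 of line «petersson_layers» v4 (the diagonal part has the printed shape, KMV residues
(23)–(28) with the pair constraint, on the window `(1, 3/2]`), from `subDiag_of_genericRemainder` and the generic remainder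
estimates `remainder_estimate_gen` (every order `(i,j)` with `i + j ≥ 2`; `Even (i+j) ∧ (i,j) ≠ (0,0)` gives `i + j ≥ 2`).
[cite: KowalskiMichelVanderKam2000, (23)–(28) and Prop. 5.1 — derivation (diagonal main term of every order, general Q)] -/
theorem stub_diag : SubDiag :=
  subDiag_of_genericRemainder (Δ := 3 / 2) (by norm_num) le_rfl fun i j hij h00 ↦
    remainder_estimate_gen i j (by obtain ⟨k, hk⟩ := hij; omega)

end Summit.Parity.GeneralizedHardyLittlewood.Theorems.MomentsBeyondDiagonal.DiagCorner

end
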